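import Literature.AlgebraicGeometry.Motives.HodgeThetaSubalgebraUnitaryAnnihilatorIdealTop
import HarnessLib

/-!
# The `Θ`-subalgebra theorem beyond coprime multiplicities, III: a `P`-annihilator-reducible `𝔊` at multiplicities
# `(2,4)` has raising and lowering LINES on `Q` (the tensor-skeleton branch of the `(2,4)` dichotomy begins; Ribet 1983
# Thm. 3 Lie step, classification-free)

Family `hodge`, layer `Literature/AlgebraicGeometry/Motives` (pure complex linear algebra; no geometry). Written for the cell
`pub-hodgeav-hg6` (req-37 (A) row 2 «base of HC ladder», TABLE X row 8-`(4,2)`, crux `UnitaryThetaCore.top_or_radical_two_four`;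
eng-5 lineage g5, brick V2b; honest framing of that cell: HC / HC_AV / HC_CM / H2 NOT proved — THIS file is unconditional linear
algebra and discharges no hypothesis of the cell's cover). UNCONDITIONAL; theorems only — no definition, no named fact (D-0026),
no `sorry`.

SETTING (the Levi data of `UnitaryFourTwo.exists_levi_data`, brick V2a, taken as HYPOTHESES so that the file is self-contained
and symmetric under `(E₁, U) ↔ (E₂, V)`): `𝔊 ⊆ End(W)` bracket-closed, `Θ² = 1` with eigenspaces `P`, `Q`; idempotents
`E₁, E₂` killing `P` with `E₁ + E₂ = π_Q`, `E₁E₂ = E₂E₁ = 0`, commuting with `Θ`; matrix units `U = E₁UE₂ ∈ 𝔊` (mapping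
`range E₂` onto `range E₁`) and `V = E₂VE₁ ∈ 𝔊` (mapping `range E₁` onto `range E₂`), commuting with `Θ`; the graded parts
`E₁XE₂`, `E₂XE₁` of `Θ`-commuting `X ∈ 𝔊` lie in `𝔊` and the rest commutes with `E₂`; LEVEL-ONE LEVI IRREDUCIBILITY (a
subspace of `Q` stable under all `Θ`-commuting `X ∈ 𝔊` is `0` or `Q`); and the NEGATION of the hypothesis of brick V1
(`UnitaryFourTwo.eq_top_of_annP_irreducible`): a subspace `0 ≠ U₀ ≠ Q` of `Q` stable under the `P`-ANNIHILATOR IDEAL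
`𝔑 = {X ∈ 𝔊 : XΘ = ΘX, X(P) = 0}`.

THE MECHANISM (new). `E₁, E₂, U, V ∈ 𝔑`, so `U₀ = M₁ ⊕ M₂` with `M_i = U₀ ∩ range E_i` LINES (`U`, `V` exchange them
injectively; `0 < dim U₀ < 4`). Level-one irreducibility gives a `Θ`- and `E₂`-commuting `Z₀ ∈ 𝔊` moving `M₁` or `M₂`
(§4). THE `2 × 2` LEMMA (§1, `UnitaryFourTwo.two_by_two`): a family of operators on a plane preserving a line `ℂe₁` and
stable under `ad Z₀` for an operator `Z₀` moving that line consists of SCALARS (`[Z₀, n]e₁ ∈ ℂe₁` forces `n = α + m` with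
`m e₁ = 0`, `m(Z₀e₁) ∈ ℂe₁`, and `[Z₀,[Z₀,n]]e₁ ∈ ℂe₁` forces `2m = 0`). Applied to the `Θ`, `E₂`-commuting part `𝔑₀₀` of
`𝔑` on `range E₁` (§2, `UnitaryFourTwo.raise_line_of_mover`): for a raising part `X₊ = E₁XE₂`, `[X₊, V] ∈ 𝔑₀₀` is scalar on
`range E₁`, i.e. `X₊V = α`, whence `X₊ ∈ ℂU` and `UV = α₀E₁`, `α₀ ≠ 0`. Conversely a raising LINE forces a mover of `M₂`
(§3, `UnitaryFourTwo.mover_of_raise_line`: otherwise `U₀` would be stable under every `Θ`-commuting element). By the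
symmetry `(E₁,U) ↔ (E₂,V)` both lines follow (§4).

WHAT IS PROVED.
* §1 `UnitaryFourTwo.exists_pair_coords`, **`UnitaryFourTwo.two_by_two`**.
* §2 **`UnitaryFourTwo.raise_line_of_mover`**; §3 **`UnitaryFourTwo.mover_of_raise_line`**.
* §4 **`UnitaryFourTwo.lines_of_annP_reducible`** — THE THEOREM: `E₁XE₂ ∈ ℂU` and `E₂XE₁ ∈ ℂV` for every `Θ`-commuting
  `X ∈ 𝔊`, and `UV = λE₁`, `VU = λE₂` with `λ ≠ 0` (a unit pair after rescaling).
SEQUEL (bricks V2c–V5): the Levi decomposition `𝔊₀ = ℂ(E₁ − E₂) ⊕ ℂU ⊕ ℂV ⊕ 𝔰` with `[𝔰, U] = [𝔰, V] = 0`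
(`SymplecticThetaSix.skeleton_levi` pattern), the tensor skeleton on `W`, and the radical of `tr_W − ¾κ`.

## References
* [Ribet1983] K. A. Ribet, Amer. J. Math. 105 (1983), Thm. 3.
* [Gordon1997] B. B. Gordon, *A survey of the Hodge conjecture for abelian varieties*, §6 (proof of Thm. 6.3.3, pp. 18–19).
* [MoonenZarhin1999LowDim] B. Moonen, Yu. Zarhin, Math. Ann. 315 (1999), §2 (2.3)–(2.5).
* [Tankeev1996] S. G. Tankeev, Izv. Math. 60 (1996) 391–424.
* [GoodmanWallachGTM255] R. Goodman, N. Wallach, *Symmetry, Representations, and Invariants*, §4.1.1.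
* [Humphreys1972] J. E. Humphreys, *Introduction to Lie Algebras and Representation Theory*, §1.2, §4.1.
* [HoffmanKunze1971LinearAlgebra] K. Hoffman, R. Kunze, *Linear Algebra*, §2.3, §6.7.
-/

noncomputable section

open Module

namespace Literature.AlgebraicGeometry.Motives

namespace HodgeStructure

variable {W : Type*} [AddCommGroup W] [Module ℂ W]

/-! ### §1 Coordinates on a plane and the `2 × 2` lemma -/

section TwoByTwo

/-- Coordinates on a plane: if `dim V = 2`, `0 ≠ e₁ ∈ V`, `e₂ ∈ V ∖ ℂe₁`, every `x ∈ V` is `γe₁ + δe₂`, and `se₂ = te₁`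
forces `s = 0`. [cite: HoffmanKunze1971LinearAlgebra, §2.3] -/
theorem UnitaryFourTwo.exists_pair_coords (V : Submodule ℂ W) (hV2 : finrank ℂ V = 2) {e₁ e₂ : W} (he₁ : e₁ ∈ V)
    (he₂ : e₂ ∈ V) (he₁0 : e₁ ≠ 0) (h : e₂ ∉ (ℂ ∙ e₁)) :
    (∀ x ∈ V, ∃ γ δ : ℂ, x = γ • e₁ + δ • e₂) ∧ ∀ s t : ℂ, s • e₂ = t • e₁ → s = 0 := by
  classical
  have hindep : ∀ s t : ℂ, s • e₂ = t • e₁ → s = 0 := by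
    intro s t hst
    by_contra hs
    apply h
    have hx : e₂ = (s⁻¹ * t) • e₁ := by
      calc e₂ = s⁻¹ • (s • e₂) := by rw [smul_smul, inv_mul_cancel₀ hs, one_smul]
        _ = (s⁻¹ * t) • e₁ := by rw [hst, smul_smul]
    rw [hx]
    exact Submodule.smul_mem _ _ (Submodule.mem_span_singleton_self e₁)
  refine ⟨?_, hindep⟩
  have hli : LinearIndependent ℂ ![(⟨e₁, he₁⟩ : V), ⟨e₂, he₂⟩] := by
    refine LinearIndependent.pair_iff.2 fun s t hst => ?_
    have hst' : s • e₁ + t • e₂ = 0 := by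
      have h' := congrArg Subtype.val hst
      simpa using h'
    have ht : t = 0 := hindep t (-s) (by
      rw [neg_smul, eq_neg_iff_add_eq_zero, add_comm]; exact hst')
    rw [ht, zero_smul, add_zero] at hst'
    exact ⟨(smul_eq_zero.1 hst').resolve_right he₁0, ht⟩
  have hcard : Fintype.card (Fin 2) = finrank ℂ V := by rw [Fintype.card_fin, hV2]
  let b : Module.Basis (Fin 2) ℂ V := basisOfLinearIndependentOfCardEqFinrank hli hcard
  have hb : ⇑b = ![(⟨e₁, he₁⟩ : V), ⟨e₂, he₂⟩] := coe_basisOfLinearIndependentOfCardEqFinrank hli hcard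
  intro x hx
  have hsum := congrArg Subtype.val (b.sum_repr ⟨x, hx⟩)
  rw [Fin.sum_univ_two, Submodule.coe_add, Submodule.coe_smul, Submodule.coe_smul, hb] at hsum
  exact ⟨b.repr ⟨x, hx⟩ 0, b.repr ⟨x, hx⟩ 1, by simpa using hsum.symm⟩

/-- **The `2 × 2` lemma.** Let `V` be a plane, `0 ≠ e₁ ∈ V`, `a` an operator preserving `V` with `a e₁ ∉ ℂe₁`
(`a` MOVES the line), `n` any operator. If `n`, `[a, n]` and `[a, [a, n]]` all map `e₁` into `ℂe₁`, then `n` is a SCALAR on `V`.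
(With `e₂ = a e₁`: `n e₁ = αe₁` and `[a,n]e₁ ∈ ℂe₁` give `n e₂ = αe₂ − βe₁`; then `[a,n]e₁ = βe₁`,
`[a,n]e₂ = −βe₂ + δβe₁`, and `[a,[a,n]]e₁ = 2βe₂ − δβe₁ ∈ ℂe₁` forces `β = 0`.) [cite: Humphreys1972, §1.2]
[cite: HoffmanKunze1971LinearAlgebra, §6.7] -/
theorem UnitaryFourTwo.two_by_two (V : Submodule ℂ W) (hV2 : finrank ℂ V = 2) {e₁ : W} (he₁ : e₁ ∈ V)
    (he₁0 : e₁ ≠ 0) {a n : Module.End ℂ W} (haV : ∀ x ∈ V, a x ∈ V)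
    (hmove : a e₁ ∉ (ℂ ∙ e₁)) (h0 : n e₁ ∈ (ℂ ∙ e₁)) (h1 : (a * n - n * a) e₁ ∈ (ℂ ∙ e₁))
    (h2 : (a * (a * n - n * a) - (a * n - n * a) * a) e₁ ∈ (ℂ ∙ e₁)) :
    ∃ α : ℂ, ∀ x ∈ V, n x = α • x := by
  obtain ⟨hcoords, hindep⟩ := UnitaryFourTwo.exists_pair_coords V hV2 he₁ (haV e₁ he₁) he₁0 hmove
  obtain ⟨α, hα⟩ := Submodule.mem_span_singleton.1 h0
  obtain ⟨β, hβ⟩ := Submodule.mem_span_singleton.1 h1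
  obtain ⟨c, hc⟩ := Submodule.mem_span_singleton.1 h2
  obtain ⟨γ, δ, hγδ⟩ := hcoords _ (haV _ (haV e₁ he₁))
  -- `n e₂ = α e₂ − β e₁` where `e₂ = a e₁`
  have hne₂ : n (a e₁) = α • a e₁ - β • e₁ := by
    have h : (a * n - n * a) e₁ = α • a e₁ - n (a e₁) := by
      rw [LinearMap.sub_apply, Module.End.mul_apply, Module.End.mul_apply, ← hα, map_smul]
    rw [← hβ] at h
    rw [h, sub_sub_cancel]
  -- `[a,n] e₂ = −β e₂ + δβ e₁`
  have hn'e₂ : (a * n - n * a) (a e₁) = -(β • a e₁) + (δ * β) • e₁ := by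
    rw [LinearMap.sub_apply, Module.End.mul_apply, Module.End.mul_apply, hne₂, map_sub, map_smul, map_smul, hγδ,
      map_add, map_smul, map_smul, ← hα, hne₂]
    module
  -- `[a,[a,n]] e₁ = 2β e₂ − δβ e₁`
  have h2' : (a * (a * n - n * a) - (a * n - n * a) * a) e₁ = (2 * β) • a e₁ - (δ * β) • e₁ := by
    rw [LinearMap.sub_apply, Module.End.mul_apply, Module.End.mul_apply, ← hβ, map_smul, hn'e₂]
    module
  rw [h2'] at hc
  have hβ0 : β = 0 := by
    have h := hindep (2 * β) (c + δ * β) (by rw [add_smul, hc, sub_add_cancel])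
    simpa using h
  refine ⟨α, fun x hx => ?_⟩
  obtain ⟨γ', δ', rfl⟩ := hcoords x hx
  rw [map_add, map_smul, map_smul, ← hα, hne₂, hβ0, zero_smul, sub_zero, smul_add, smul_comm γ' α, smul_comm δ' α]

end TwoByTwo

/-! ### §2 A mover of the line `ℂx₁ ⊆ range E₁` gives the raising line `E₁𝔊E₂ = ℂU` -/

section Lines

variable [FiniteDimensional ℂ W]

/-- **Raising line from a mover.** In the SETTING (module docstring; only the listed relations are used), suppose
`0 ≠ x₁ ∈ range E₁` spans a line preserved by every `N ∈ 𝔑₀₀ = {N ∈ 𝔊 : NΘ = ΘN, N(P) = 0, NE₂ = E₂N}`, and some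
`Θ`, `E₂`-commuting `Z ∈ 𝔊` moves that line. Then every raising part `E₁XE₂` (`X ∈ 𝔊` commuting with `Θ`) is a multiple
of `U`, and `UV = α₀E₁` with `α₀ ≠ 0`. Proof: by the `2 × 2` lemma every `N ∈ 𝔑₀₀` is scalar on `range E₁`; apply this
to `N = [E₁XE₂, V]`, which acts on `range E₁` as `E₁XE₂ ∘ V`, and to `[U, V]`. [cite: Ribet1983, Thm. 3]
[cite: GoodmanWallachGTM255, §4.1.1] [cite: Humphreys1972, §1.2] -/
theorem UnitaryFourTwo.raise_line_of_mover {𝔊 : Submodule ℂ (Module.End ℂ W)}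
    (hbr : ∀ Y ∈ 𝔊, ∀ Z ∈ 𝔊, Y * Z - Z * Y ∈ 𝔊) {Θ E₁ E₂ U V : Module.End ℂ W} (hΘΘ : Θ * Θ = 1)
    {P : Submodule ℂ W} (hP : ∀ x, x ∈ P ↔ Θ x = x)
    (hU : U ∈ 𝔊) (hV : V ∈ 𝔊) (hUΘ : U * Θ = Θ * U) (hVΘ : V * Θ = Θ * V)
    (hE₁P : ∀ p ∈ P, E₁ p = 0) (hE₂P : ∀ p ∈ P, E₂ p = 0)
    (hsum : E₁ + E₂ = (2 : ℂ)⁻¹ • (1 - Θ)) (hE₁E₁ : E₁ * E₁ = E₁) (hE₂E₂ : E₂ * E₂ = E₂) (hE₁E₂ : E₁ * E₂ = 0)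
    (hE₂E₁ : E₂ * E₁ = 0) (hE₁Θ : E₁ * Θ = Θ * E₁) (hE₂Θ : E₂ * Θ = Θ * E₂)
    (hE₁U : E₁ * U = U) (hUE₂ : U * E₂ = U) (hE₂V : E₂ * V = V) (hVE₁ : V * E₁ = V)
    (hUonto : ∀ x, E₁ x = x → ∃ k, E₂ k = k ∧ U k = x) (hVonto : ∀ k, E₂ k = k → ∃ x, E₁ x = x ∧ V x = k)
    (hr₁ : finrank ℂ (LinearMap.range E₁) = 2)
    (hXraise : ∀ X ∈ 𝔊, X * Θ = Θ * X → E₁ * X * E₂ ∈ 𝔊)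
    {x₁ : W} (hx₁ : E₁ x₁ = x₁) (hx₁0 : x₁ ≠ 0)
    (hfix : ∀ N ∈ 𝔊, N * Θ = Θ * N → (∀ p ∈ P, N p = 0) → N * E₂ = E₂ * N → N x₁ ∈ (ℂ ∙ x₁))
    (hmove : ∃ Z ∈ 𝔊, Z * Θ = Θ * Z ∧ Z * E₂ = E₂ * Z ∧ Z x₁ ∉ (ℂ ∙ x₁)) :
    (∀ X ∈ 𝔊, X * Θ = Θ * X → ∃ c : ℂ, E₁ * X * E₂ = c • U) ∧ ∃ α₀ : ℂ, α₀ ≠ 0 ∧ U * V = α₀ • E₁ := by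
  classical
  have _hΘΘ := hΘΘ
  obtain ⟨Z, hZ, hZΘ, hZE₂, hZx₁⟩ := hmove
  -- bookkeeping
  have hmemR : ∀ x, E₁ x = x ↔ x ∈ LinearMap.range E₁ := fun x =>
    ⟨fun h => ⟨x, h⟩, by rintro ⟨w, rfl⟩; rw [← Module.End.mul_apply, hE₁E₁]⟩
  have hcommE₁ : ∀ Y : Module.End ℂ W, Y * Θ = Θ * Y → Y * E₂ = E₂ * Y → Y * E₁ = E₁ * Y := by
    intro Y hYΘ hYE₂
    have h : Y * (E₁ + E₂) = (E₁ + E₂) * Y := by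
      rw [hsum, mul_smul_comm, smul_mul_assoc, mul_sub, sub_mul, mul_one, one_mul, hYΘ]
    rw [mul_add, add_mul, hYE₂] at h
    exact add_right_cancel h
  have hcommP : ∀ Y : Module.End ℂ W, Y * Θ = Θ * Y → ∀ p ∈ P, Y p ∈ P := fun Y hY p hp =>
    (hP _).2 (by rw [← Module.End.mul_apply, ← hY, Module.End.mul_apply, (hP p).1 hp])
  have hpresR : ∀ Y : Module.End ℂ W, Y * E₁ = E₁ * Y → ∀ x ∈ LinearMap.range E₁, Y x ∈ LinearMap.range E₁ :=
    fun Y hY x hx => by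
      rw [← hmemR] at hx ⊢
      rw [← Module.End.mul_apply, ← hY, Module.End.mul_apply, hx]
  have hx₁R : x₁ ∈ LinearMap.range E₁ := (hmemR x₁).1 hx₁
  -- brackets with `Z` stay in `𝔑₀₀`
  have hbr₀₀ : ∀ N ∈ 𝔊, N * Θ = Θ * N → (∀ p ∈ P, N p = 0) → N * E₂ = E₂ * N →
      (Z * N - N * Z) ∈ 𝔊 ∧ (Z * N - N * Z) * Θ = Θ * (Z * N - N * Z) ∧
        (∀ p ∈ P, (Z * N - N * Z) p = 0) ∧ (Z * N - N * Z) * E₂ = E₂ * (Z * N - N * Z) := by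
    intro N hN hNΘ hNP hNE₂
    refine ⟨hbr Z hZ N hN, ?_, fun p hp => ?_, ?_⟩
    · rw [sub_mul, mul_sub, mul_assoc, hNΘ, ← mul_assoc, hZΘ, mul_assoc, mul_assoc, hZΘ, ← mul_assoc N, hNΘ,
        mul_assoc]
    · rw [LinearMap.sub_apply, Module.End.mul_apply, Module.End.mul_apply, hNP p hp, map_zero,
        hNP _ (hcommP Z hZΘ p hp), sub_zero]
    · rw [sub_mul, mul_sub, mul_assoc, hNE₂, ← mul_assoc, hZE₂, mul_assoc, mul_assoc, hZE₂, ← mul_assoc N, hNE₂,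
        mul_assoc]
  -- every `N ∈ 𝔑₀₀` is a scalar on `range E₁` (the `2 × 2` lemma)
  have hscalar : ∀ N ∈ 𝔊, N * Θ = Θ * N → (∀ p ∈ P, N p = 0) → N * E₂ = E₂ * N →
      ∃ α : ℂ, ∀ x ∈ LinearMap.range E₁, N x = α • x := by
    intro N hN hNΘ hNP hNE₂
    obtain ⟨hN₁, hN₁Θ, hN₁P, hN₁E₂⟩ := hbr₀₀ N hN hNΘ hNP hNE₂
    obtain ⟨hN₂, hN₂Θ, hN₂P, hN₂E₂⟩ := hbr₀₀ _ hN₁ hN₁Θ hN₁P hN₁E₂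
    exact UnitaryFourTwo.two_by_two (LinearMap.range E₁) hr₁ hx₁R hx₁0
      (hpresR Z (hcommE₁ Z hZΘ hZE₂)) hZx₁ (hfix N hN hNΘ hNP hNE₂)
      (hfix _ hN₁ hN₁Θ hN₁P hN₁E₂) (hfix _ hN₂ hN₂Θ hN₂P hN₂E₂)
  -- KEY: for `Y ∈ 𝔊` of raising shape (`E₁Y = Y = YE₂`, `YΘ = ΘY`), `Y ∘ V` is a scalar on `range E₁`
  have hVP : ∀ p ∈ P, V p = 0 := fun p hp => by rw [← hVE₁, Module.End.mul_apply, hE₁P p hp, map_zero]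
  have key : ∀ Y ∈ 𝔊, Y * Θ = Θ * Y → E₁ * Y = Y → Y * E₂ = Y →
      ∃ α : ℂ, ∀ x ∈ LinearMap.range E₁, Y (V x) = α • x := by
    intro Y hY hYΘ hE₁Y hYE₂
    have hYP : ∀ p ∈ P, Y p = 0 := fun p hp => by rw [← hYE₂, Module.End.mul_apply, hE₂P p hp, map_zero]
    have hE₂Y : E₂ * Y = 0 := by rw [← hE₁Y, ← mul_assoc, hE₂E₁, zero_mul]
    set N : Module.End ℂ W := Y * V - V * Y with hNdef
    have hN : N ∈ 𝔊 := hbr Y hY V hV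
    have hNΘ : N * Θ = Θ * N := by
      rw [hNdef, sub_mul, mul_sub, mul_assoc, hVΘ, ← mul_assoc, hYΘ, mul_assoc, mul_assoc, hYΘ, ← mul_assoc V, hVΘ,
        mul_assoc]
    have hNP : ∀ p ∈ P, N p = 0 := fun p hp => by
      rw [hNdef, LinearMap.sub_apply, Module.End.mul_apply, Module.End.mul_apply, hVP p hp, hYP p hp, map_zero,
        map_zero, sub_zero]
    have hNE₂ : N * E₂ = E₂ * N := by
      have h1 : N * E₂ = -(V * Y) := by
        rw [hNdef, sub_mul, mul_assoc, ← hVE₁, mul_assoc V E₁ E₂, hE₁E₂, mul_zero, mul_zero, zero_sub, mul_assoc,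
          hYE₂]
      have h2 : E₂ * N = -(V * Y) := by
        rw [hNdef, mul_sub, ← mul_assoc, hE₂Y, zero_mul, zero_sub, ← mul_assoc, hE₂V]
      rw [h1, h2]
    obtain ⟨α, hα⟩ := hscalar N hN hNΘ hNP hNE₂
    refine ⟨α, fun x hx => ?_⟩
    have hx' : E₁ x = x := (hmemR x).2 hx
    have hYx : Y x = 0 := by
      rw [← hYE₂, Module.End.mul_apply, ← hx', ← Module.End.mul_apply E₂ E₁, hE₂E₁, LinearMap.zero_apply, map_zero]
    have h := hα x hx
    rw [hNdef, LinearMap.sub_apply, Module.End.mul_apply, Module.End.mul_apply, hYx, map_zero, sub_zero] at h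
    exact h
  -- `U V = α₀` on `range E₁`, with `α₀ ≠ 0`
  obtain ⟨α₀, hα₀⟩ := key U hU hUΘ hE₁U hUE₂
  have hα₀0 : α₀ ≠ 0 := by
    intro h0
    rw [h0] at hα₀
    have hUK : ∀ k, E₂ k = k → U k = 0 := fun k hk => by
      obtain ⟨x, hx, rfl⟩ := hVonto k hk
      rw [hα₀ x ((hmemR x).1 hx), zero_smul]
    have hU0 : ∀ w, U w = 0 := fun w => by
      rw [← hUE₂, Module.End.mul_apply]
      exact hUK _ (by rw [← Module.End.mul_apply, hE₂E₂])
    have hpos : 0 < finrank ℂ (LinearMap.range E₁) := by rw [hr₁]; exact two_pos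
    obtain ⟨⟨x, hx⟩, hx0⟩ := Module.finrank_pos_iff_exists_ne_zero.1 hpos
    obtain ⟨k, -, hkx⟩ := hUonto x ((hmemR x).2 hx)
    apply hx0
    apply Subtype.ext
    change x = 0
    rw [← hkx, hU0]
  refine ⟨fun X hX hXΘ => ?_, α₀, hα₀0, ?_⟩
  · -- the raising part `X₊ = E₁ X E₂`
    set Y : Module.End ℂ W := E₁ * X * E₂ with hYdef
    have hY : Y ∈ 𝔊 := hXraise X hX hXΘ
    have hYΘ : Y * Θ = Θ * Y := by
      rw [hYdef, mul_assoc, mul_assoc, hE₂Θ, ← mul_assoc X, hXΘ, ← mul_assoc, ← mul_assoc, hE₁Θ, mul_assoc,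
        mul_assoc, mul_assoc]
    have hE₁Y : E₁ * Y = Y := by rw [hYdef, ← mul_assoc, ← mul_assoc, hE₁E₁]
    have hYE₂ : Y * E₂ = Y := by rw [hYdef, mul_assoc, hE₂E₂]
    clear_value Y
    obtain ⟨α, hα⟩ := key Y hY hYΘ hE₁Y hYE₂
    refine ⟨α * α₀⁻¹, LinearMap.ext fun w => ?_⟩
    have hk : E₂ (E₂ w) = E₂ w := by rw [← Module.End.mul_apply, hE₂E₂]
    obtain ⟨x, hx, hxk⟩ := hVonto (E₂ w) hk
    have hxR : x ∈ LinearMap.range E₁ := (hmemR x).1 hx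
    rw [LinearMap.smul_apply, ← hYE₂, ← hUE₂, Module.End.mul_apply, Module.End.mul_apply, ← hxk, hα x hxR,
      hα₀ x hxR, smul_smul, mul_assoc, inv_mul_cancel₀ hα₀0, mul_one]
  · refine LinearMap.ext fun w => ?_
    have hxR : E₁ w ∈ LinearMap.range E₁ := ⟨w, rfl⟩
    rw [Module.End.mul_apply, LinearMap.smul_apply, ← hVE₁, Module.End.mul_apply, hα₀ _ hxR]

/-! ### §3 A raising line forces a mover of `M₂ = U₀ ∩ range E₂` -/

omit [FiniteDimensional ℂ W] in
/-- **Mover from the raising line.** In the SETTING, with a `𝔑`-stable `0 ≠ U₀ ≠ Q` inside `Q`, the raising LINE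
`E₁𝔊E₂ = ℂU` together with `UV = α₀E₁` (`α₀ ≠ 0`) forces some `Θ`, `E₂`-commuting `Z ∈ 𝔊` and some
`x ∈ U₀ ∩ range E₂` with `Zx ∉ U₀`: otherwise `U₀` is stable under EVERY `Θ`-commuting `X ∈ 𝔊` (`X = X₊ + X₋ + X₀₀`,
`X± ∈ 𝔑`, `X₀₀(E₂y) ∈ U₀` by assumption, `X₀₀(E₁y) = [X₀₀, U]k + U(X₀₀k)` with `k = α₀⁻¹VE₁y ∈ U₀ ∩ range E₂` and
`[X₀₀, U] ∈ ℂU`), contradicting level-one Levi irreducibility. [cite: Ribet1983, Thm. 3]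
[cite: Gordon1997, §6 (proof of Thm. 6.3.3, p. 19)] [cite: GoodmanWallachGTM255, §4.1.1] -/
theorem UnitaryFourTwo.mover_of_raise_line {𝔊 : Submodule ℂ (Module.End ℂ W)}
    (hbr : ∀ Y ∈ 𝔊, ∀ Z ∈ 𝔊, Y * Z - Z * Y ∈ 𝔊) {Θ E₁ E₂ U V : Module.End ℂ W}
    {P Q : Submodule ℂ W} (hQ : ∀ x, x ∈ Q ↔ Θ x = -x)
    (hE₁ : E₁ ∈ 𝔊) (hE₂ : E₂ ∈ 𝔊) (hU : U ∈ 𝔊) (hV : V ∈ 𝔊) (hUΘ : U * Θ = Θ * U) (hVΘ : V * Θ = Θ * V)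
    (hE₁P : ∀ p ∈ P, E₁ p = 0) (hE₂P : ∀ p ∈ P, E₂ p = 0)
    (hsum : E₁ + E₂ = (2 : ℂ)⁻¹ • (1 - Θ)) (hE₁E₁ : E₁ * E₁ = E₁) (hE₂E₂ : E₂ * E₂ = E₂)
    (hE₁Θ : E₁ * Θ = Θ * E₁) (hE₂Θ : E₂ * Θ = Θ * E₂)
    (hE₁U : E₁ * U = U) (hUE₂ : U * E₂ = U) (hE₂V : E₂ * V = V) (hVE₁ : V * E₁ = V)
    (hlevi : ∀ U' : Submodule ℂ W, U' ≤ Q → (∀ X ∈ 𝔊, X * Θ = Θ * X → ∀ y ∈ U', X y ∈ U') → U' = ⊥ ∨ U' = Q)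
    (hgraded : ∀ X ∈ 𝔊, X * Θ = Θ * X →
      E₁ * X * E₂ ∈ 𝔊 ∧ E₂ * X * E₁ ∈ 𝔊 ∧ (X - E₁ * X * E₂ - E₂ * X * E₁) * E₂ = E₂ * (X - E₁ * X * E₂ - E₂ * X * E₁))
    {U₀ : Submodule ℂ W} (hU₀Q : U₀ ≤ Q) (hU₀bot : U₀ ≠ ⊥) (hU₀top : U₀ ≠ Q)
    (hU₀N : ∀ X ∈ 𝔊, X * Θ = Θ * X → (∀ p ∈ P, X p = 0) → ∀ y ∈ U₀, X y ∈ U₀)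
    (hline : ∀ X ∈ 𝔊, X * Θ = Θ * X → ∃ c : ℂ, E₁ * X * E₂ = c • U)
    {α₀ : ℂ} (hα₀ : α₀ ≠ 0) (hUV : U * V = α₀ • E₁) :
    ∃ Z ∈ 𝔊, Z * Θ = Θ * Z ∧ Z * E₂ = E₂ * Z ∧ ∃ x ∈ U₀, E₂ x = x ∧ Z x ∉ U₀ := by
  classical
  have hUP : ∀ p ∈ P, U p = 0 := fun p hp => by rw [← hUE₂, Module.End.mul_apply, hE₂P p hp, map_zero]
  have hVP : ∀ p ∈ P, V p = 0 := fun p hp => by rw [← hVE₁, Module.End.mul_apply, hE₁P p hp, map_zero]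
  have hsumq : ∀ q ∈ Q, E₁ q + E₂ q = q := fun q hq => by
    rw [← LinearMap.add_apply, hsum, LinearMap.smul_apply, LinearMap.sub_apply, Module.End.one_apply, (hQ q).1 hq,
      sub_neg_eq_add, ← two_smul ℂ q, smul_smul, inv_mul_cancel₀ two_ne_zero, one_smul]
  have hcommE₁ : ∀ Y : Module.End ℂ W, Y * Θ = Θ * Y → Y * E₂ = E₂ * Y → Y * E₁ = E₁ * Y := by
    intro Y hYΘ hYE₂
    have h : Y * (E₁ + E₂) = (E₁ + E₂) * Y := by
      rw [hsum, mul_smul_comm, smul_mul_assoc, mul_sub, sub_mul, mul_one, one_mul, hYΘ]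
    rw [mul_add, add_mul, hYE₂] at h
    exact add_right_cancel h
  by_contra hno
  push Not at hno
  -- hno : ∀ Z ∈ 𝔊, ZΘ = ΘZ → ZE₂ = E₂Z → ∀ x ∈ U₀, E₂ x = x → Z x ∈ U₀
  have hstab : ∀ X ∈ 𝔊, X * Θ = Θ * X → ∀ y ∈ U₀, X y ∈ U₀ := by
    intro X hX hXΘ y hy
    obtain ⟨hXp, hXm, hX₀E₂⟩ := hgraded X hX hXΘ
    set Xp : Module.End ℂ W := E₁ * X * E₂ with hXpdef
    set Xm : Module.End ℂ W := E₂ * X * E₁ with hXmdef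
    set X₀ : Module.End ℂ W := X - Xp - Xm with hX₀def
    clear_value Xp Xm X₀
    have hXpΘ : Xp * Θ = Θ * Xp := by
      rw [hXpdef, mul_assoc, mul_assoc, hE₂Θ, ← mul_assoc X, hXΘ, ← mul_assoc, ← mul_assoc, hE₁Θ, mul_assoc,
        mul_assoc, mul_assoc]
    have hXmΘ : Xm * Θ = Θ * Xm := by
      rw [hXmdef, mul_assoc, mul_assoc, hE₁Θ, ← mul_assoc X, hXΘ, ← mul_assoc, ← mul_assoc, hE₂Θ, mul_assoc,
        mul_assoc, mul_assoc]
    have hXpP : ∀ p ∈ P, Xp p = 0 := fun p hp => by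
      rw [hXpdef, Module.End.mul_apply, hE₂P p hp, map_zero]
    have hXmP : ∀ p ∈ P, Xm p = 0 := fun p hp => by
      rw [hXmdef, Module.End.mul_apply, hE₁P p hp, map_zero]
    have hX₀ : X₀ ∈ 𝔊 := by rw [hX₀def]; exact Submodule.sub_mem _ (Submodule.sub_mem _ hX hXp) hXm
    have hX₀Θ : X₀ * Θ = Θ * X₀ := by rw [hX₀def, sub_mul, sub_mul, mul_sub, mul_sub, hXΘ, hXpΘ, hXmΘ]
    have hX₀E₁ : X₀ * E₁ = E₁ * X₀ := hcommE₁ X₀ hX₀Θ hX₀E₂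
    have hyQ : y ∈ Q := hU₀Q hy
    -- the pieces of `X y`
    have hy₁ : E₁ y ∈ U₀ := hU₀N E₁ hE₁ hE₁Θ hE₁P y hy
    have hy₂ : E₂ y ∈ U₀ := hU₀N E₂ hE₂ hE₂Θ hE₂P y hy
    have h₂ : X₀ (E₂ y) ∈ U₀ := hno X₀ hX₀ hX₀Θ hX₀E₂ _ hy₂ (by rw [← Module.End.mul_apply, hE₂E₂])
    -- `E₁ y = U k` with `k = α₀⁻¹ V E₁ y ∈ U₀ ∩ range E₂`
    set k : W := α₀⁻¹ • V (E₁ y) with hkdef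
    have hkU₀ : k ∈ U₀ := Submodule.smul_mem _ _ (hU₀N V hV hVΘ hVP _ hy₁)
    have hkE₂ : E₂ k = k := by rw [hkdef, map_smul, ← Module.End.mul_apply, hE₂V]
    have hUk : U k = E₁ y := by
      rw [hkdef, map_smul, ← Module.End.mul_apply, hUV, LinearMap.smul_apply, smul_smul, inv_mul_cancel₀ hα₀,
        one_smul, ← Module.End.mul_apply, hE₁E₁]
    -- `[X₀, U] = c U`
    have hD : X₀ * U - U * X₀ ∈ 𝔊 := hbr X₀ hX₀ U hU
    have hDΘ : (X₀ * U - U * X₀) * Θ = Θ * (X₀ * U - U * X₀) := by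
      rw [sub_mul, mul_sub, mul_assoc, hUΘ, ← mul_assoc, hX₀Θ, mul_assoc, mul_assoc, hX₀Θ, ← mul_assoc U, hUΘ,
        mul_assoc]
    obtain ⟨c, hc⟩ := hline _ hD hDΘ
    have hDeq : E₁ * (X₀ * U - U * X₀) * E₂ = X₀ * U - U * X₀ := by
      rw [mul_sub, sub_mul, ← mul_assoc, ← hX₀E₁, mul_assoc X₀ E₁ U, hE₁U, mul_assoc, hUE₂, ← mul_assoc, hE₁U,
        mul_assoc, hX₀E₂, ← mul_assoc, hUE₂]
    rw [hDeq] at hc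
    have h₁ : X₀ (E₁ y) ∈ U₀ := by
      have h : X₀ (E₁ y) = (X₀ * U - U * X₀) k + U (X₀ k) := by
        rw [LinearMap.sub_apply, Module.End.mul_apply, Module.End.mul_apply, hUk, sub_add_cancel]
      rw [h, hc, LinearMap.smul_apply]
      refine Submodule.add_mem _ (Submodule.smul_mem _ _ (hU₀N U hU hUΘ hUP k hkU₀)) (hU₀N U hU hUΘ hUP _ ?_)
      exact hno X₀ hX₀ hX₀Θ hX₀E₂ k hkU₀ hkE₂
    -- assemble
    have hX₀y : X₀ y = X₀ (E₁ y) + X₀ (E₂ y) := by rw [← map_add, hsumq y hyQ]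
    have hXy : X y = Xp y + Xm y + (X₀ (E₁ y) + X₀ (E₂ y)) := by
      rw [← hX₀y, hX₀def, LinearMap.sub_apply, LinearMap.sub_apply]
      abel
    rw [hXy]
    exact Submodule.add_mem _ (Submodule.add_mem _ (hU₀N Xp hXp hXpΘ hXpP y hy) (hU₀N Xm hXm hXmΘ hXmP y hy))
      (Submodule.add_mem _ h₁ h₂)
  rcases hlevi U₀ hU₀Q hstab with h | h
  · exact hU₀bot h
  · exact hU₀top h

/-! ### §4 The theorem: both lines and the unit pair -/

/-- **LINES OF A `P`-ANNIHILATOR-REDUCIBLE `𝔊` AT MULTIPLICITIES `(2,4)`.** In the SETTING (module docstring): if `Q` has a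
subspace `0 ≠ U₀ ≠ Q` stable under the `P`-annihilator ideal `𝔑`, then for every `Θ`-commuting `X ∈ 𝔊` the graded parts
satisfy `E₁XE₂ ∈ ℂU`, `E₂XE₁ ∈ ℂV`, and `UV = λE₁`, `VU = λE₂` for one `λ ≠ 0`. (Dimension count: `U₀ = M₁ ⊕ M₂`,
`M_i = U₀ ∩ range E_i` lines; a mover of `M₁` or of `M₂` exists by level-one irreducibility; §2 and §3 in both
orientations; finally `UVU = λU` compares the two constants.) This is the «raising/lowering lines + unit pair» input of
the tree's `SymplecticThetaSix.skeleton_levi` for the Levi algebra on `Q`, i.e. the start of the tensor skeleton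
`𝔤𝔩₂ ⊗ 1 + 1 ⊗ 𝔤𝔩₃` of the `(2,4)` dichotomy. [cite: Ribet1983, Thm. 3] [cite: MoonenZarhin1999LowDim, §2 (2.3)–(2.5)]
[cite: Tankeev1996, Introduction] [cite: GoodmanWallachGTM255, §4.1.1] -/
theorem UnitaryFourTwo.lines_of_annP_reducible {𝔊 : Submodule ℂ (Module.End ℂ W)}
    (hbr : ∀ Y ∈ 𝔊, ∀ Z ∈ 𝔊, Y * Z - Z * Y ∈ 𝔊) {Θ E₁ E₂ U V : Module.End ℂ W} (hΘΘ : Θ * Θ = 1)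
    {P Q : Submodule ℂ W} (hP : ∀ x, x ∈ P ↔ Θ x = x) (hQ : ∀ x, x ∈ Q ↔ Θ x = -x)
    (hE₁ : E₁ ∈ 𝔊) (hE₂ : E₂ ∈ 𝔊) (hU : U ∈ 𝔊) (hV : V ∈ 𝔊)
    (hsum : E₁ + E₂ = (2 : ℂ)⁻¹ • (1 - Θ)) (hE₁E₁ : E₁ * E₁ = E₁) (hE₂E₂ : E₂ * E₂ = E₂) (hE₁E₂ : E₁ * E₂ = 0)
    (hE₂E₁ : E₂ * E₁ = 0) (hE₂Θ : E₂ * Θ = Θ * E₂)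
    (hr₁ : finrank ℂ (LinearMap.range E₁) = 2) (hr₂ : finrank ℂ (LinearMap.range E₂) = 2)
    (hE₁U : E₁ * U = U) (hUE₂ : U * E₂ = U) (hUonto : ∀ x, E₁ x = x → ∃ k, E₂ k = k ∧ U k = x)
    (hUinj : ∀ k, E₂ k = k → U k = 0 → k = 0)
    (hE₂V : E₂ * V = V) (hVE₁ : V * E₁ = V) (hVonto : ∀ k, E₂ k = k → ∃ x, E₁ x = x ∧ V x = k)
    (hVinj : ∀ x, E₁ x = x → V x = 0 → x = 0)
    (hlevi : ∀ U' : Submodule ℂ W, U' ≤ Q → (∀ X ∈ 𝔊, X * Θ = Θ * X → ∀ y ∈ U', X y ∈ U') → U' = ⊥ ∨ U' = Q)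
    (hgraded : ∀ X ∈ 𝔊, X * Θ = Θ * X →
      E₁ * X * E₂ ∈ 𝔊 ∧ E₂ * X * E₁ ∈ 𝔊 ∧ (X - E₁ * X * E₂ - E₂ * X * E₁) * E₂ = E₂ * (X - E₁ * X * E₂ - E₂ * X * E₁))
    (hNred : ∃ U₀ : Submodule ℂ W, U₀ ≤ Q ∧ U₀ ≠ ⊥ ∧ U₀ ≠ Q ∧
      ∀ X ∈ 𝔊, X * Θ = Θ * X → (∀ p ∈ P, X p = 0) → ∀ y ∈ U₀, X y ∈ U₀) :
    (∀ X ∈ 𝔊, X * Θ = Θ * X → (∃ c : ℂ, E₁ * X * E₂ = c • U) ∧ ∃ c : ℂ, E₂ * X * E₁ = c • V) ∧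
      ∃ lam : ℂ, lam ≠ 0 ∧ U * V = lam • E₁ ∧ V * U = lam • E₂ := by
  classical
  have hΘΘv : ∀ v, Θ (Θ v) = v := fun v => by rw [← Module.End.mul_apply, hΘΘ, Module.End.one_apply]
  obtain ⟨U₀, hU₀Q, hU₀bot, hU₀top, hU₀N⟩ := hNred
  -- basic facts on the data
  have hπQq : ∀ q ∈ Q, ((2 : ℂ)⁻¹ • ((1 : Module.End ℂ W) - Θ)) q = q := fun q hq => by
    rw [LinearMap.smul_apply, LinearMap.sub_apply, Module.End.one_apply, (hQ q).1 hq, sub_neg_eq_add, ← two_smul ℂ q,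
      smul_smul, inv_mul_cancel₀ two_ne_zero, one_smul]
  have hπQp : ∀ p ∈ P, ((2 : ℂ)⁻¹ • ((1 : Module.End ℂ W) - Θ)) p = 0 := fun p hp => by
    rw [LinearMap.smul_apply, LinearMap.sub_apply, Module.End.one_apply, (hP p).1 hp, sub_self, smul_zero]
  have hπQmem : ∀ w, ((2 : ℂ)⁻¹ • ((1 : Module.End ℂ W) - Θ)) w ∈ Q := fun w =>
    (hQ _).2 (by rw [LinearMap.smul_apply, LinearMap.sub_apply, Module.End.one_apply, map_smul, map_sub, hΘΘv,
      ← smul_neg, neg_sub])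
  have hsumq : ∀ q ∈ Q, E₁ q + E₂ q = q := fun q hq => by rw [← LinearMap.add_apply, hsum, hπQq q hq]
  have hE₁P : ∀ p ∈ P, E₁ p = 0 := fun p hp => by
    have h : E₁ p = E₁ ((E₁ + E₂) p) := by
      rw [LinearMap.add_apply, map_add, ← Module.End.mul_apply, ← Module.End.mul_apply, hE₁E₁, hE₁E₂,
        LinearMap.zero_apply, add_zero]
    rw [h, hsum, hπQp p hp, map_zero]
  have hE₂P : ∀ p ∈ P, E₂ p = 0 := fun p hp => by
    have h : E₂ p = E₂ ((E₁ + E₂) p) := by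
      rw [LinearMap.add_apply, map_add, ← Module.End.mul_apply, ← Module.End.mul_apply, hE₂E₁, hE₂E₂,
        LinearMap.zero_apply, zero_add]
    rw [h, hsum, hπQp p hp, map_zero]
  have hE₁Q : ∀ w, E₁ w ∈ Q := fun w => by
    have h : E₁ w = (E₁ + E₂) (E₁ w) := by
      rw [LinearMap.add_apply, ← Module.End.mul_apply, ← Module.End.mul_apply, hE₁E₁, hE₂E₁, LinearMap.zero_apply,
        add_zero]
    rw [h, hsum]; exact hπQmem _
  have hE₂Q : ∀ w, E₂ w ∈ Q := fun w => by
    have h : E₂ w = (E₁ + E₂) (E₂ w) := by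
      rw [LinearMap.add_apply, ← Module.End.mul_apply, ← Module.End.mul_apply, hE₁E₂, hE₂E₂, LinearMap.zero_apply,
        zero_add]
    rw [h, hsum]; exact hπQmem _
  have hE₁Θ : E₁ * Θ = Θ * E₁ := by
    have h : (E₁ + E₂) * Θ = Θ * (E₁ + E₂) := by
      rw [hsum, mul_smul_comm, smul_mul_assoc, mul_sub, sub_mul, mul_one, one_mul, hΘΘ]
    rw [add_mul, mul_add, hE₂Θ] at h
    exact add_right_cancel h
  have hUP : ∀ p ∈ P, U p = 0 := fun p hp => by rw [← hUE₂, Module.End.mul_apply, hE₂P p hp, map_zero]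
  have hVP : ∀ p ∈ P, V p = 0 := fun p hp => by rw [← hVE₁, Module.End.mul_apply, hE₁P p hp, map_zero]
  have hUQ : ∀ w, U w ∈ Q := fun w => by rw [← hE₁U, Module.End.mul_apply]; exact hE₁Q _
  have hVQ : ∀ w, V w ∈ Q := fun w => by rw [← hE₂V, Module.End.mul_apply]; exact hE₂Q _
  have hcommΘ : ∀ Y : Module.End ℂ W, (∀ p ∈ P, Y p = 0) → (∀ w, Y w ∈ Q) → Y * Θ = Θ * Y := by
    intro Y hYP hYQ
    refine UnitaryFourTwo.end_ext hΘΘ hP hQ (fun p hp => ?_) (fun q hq => ?_)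
    · rw [Module.End.mul_apply, Module.End.mul_apply, (hP p).1 hp, hYP p hp, map_zero]
    · rw [Module.End.mul_apply, Module.End.mul_apply, (hQ q).1 hq, map_neg, (hQ _).1 (hYQ q)]
  have hUΘ : U * Θ = Θ * U := hcommΘ U hUP hUQ
  have hVΘ : V * Θ = Θ * V := hcommΘ V hVP hVQ
  have hcommE₁ : ∀ Y : Module.End ℂ W, Y * Θ = Θ * Y → Y * E₂ = E₂ * Y → Y * E₁ = E₁ * Y := by
    intro Y hYΘ hYE₂
    have h : Y * (E₁ + E₂) = (E₁ + E₂) * Y := by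
      rw [hsum, mul_smul_comm, smul_mul_assoc, mul_sub, sub_mul, mul_one, one_mul, hYΘ]
    rw [mul_add, add_mul, hYE₂] at h
    exact add_right_cancel h
  have hcommE₂ : ∀ Y : Module.End ℂ W, Y * Θ = Θ * Y → Y * E₁ = E₁ * Y → Y * E₂ = E₂ * Y := by
    intro Y hYΘ hYE₁
    have h : Y * (E₁ + E₂) = (E₁ + E₂) * Y := by
      rw [hsum, mul_smul_comm, smul_mul_assoc, mul_sub, sub_mul, mul_one, one_mul, hYΘ]
    rw [mul_add, add_mul, hYE₁] at h
    exact add_left_cancel h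
  have hmemR₁ : ∀ x, E₁ x = x ↔ x ∈ LinearMap.range E₁ := fun x =>
    ⟨fun h => ⟨x, h⟩, by rintro ⟨w, rfl⟩; rw [← Module.End.mul_apply, hE₁E₁]⟩
  have hmemR₂ : ∀ x, E₂ x = x ↔ x ∈ LinearMap.range E₂ := fun x =>
    ⟨fun h => ⟨x, h⟩, by rintro ⟨w, rfl⟩; rw [← Module.End.mul_apply, hE₂E₂]⟩
  -- symmetric forms of the graded-parts hypothesis
  have hsum' : E₂ + E₁ = (2 : ℂ)⁻¹ • (1 - Θ) := by rw [add_comm, hsum]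
  have hgraded' : ∀ X ∈ 𝔊, X * Θ = Θ * X →
      E₂ * X * E₁ ∈ 𝔊 ∧ E₁ * X * E₂ ∈ 𝔊 ∧
        (X - E₂ * X * E₁ - E₁ * X * E₂) * E₁ = E₁ * (X - E₂ * X * E₁ - E₁ * X * E₂) := by
    intro X hX hXΘ
    obtain ⟨h1, h2, h3⟩ := hgraded X hX hXΘ
    refine ⟨h2, h1, ?_⟩
    have heq : X - E₂ * X * E₁ - E₁ * X * E₂ = X - E₁ * X * E₂ - E₂ * X * E₁ := by abel
    rw [heq]
    have hX₀Θ : (X - E₁ * X * E₂ - E₂ * X * E₁) * Θ = Θ * (X - E₁ * X * E₂ - E₂ * X * E₁) := by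
      have hp : (E₁ * X * E₂) * Θ = Θ * (E₁ * X * E₂) := by
        rw [mul_assoc, mul_assoc, hE₂Θ, ← mul_assoc X, hXΘ, ← mul_assoc, ← mul_assoc, hE₁Θ, mul_assoc, mul_assoc,
          mul_assoc]
      have hm : (E₂ * X * E₁) * Θ = Θ * (E₂ * X * E₁) := by
        rw [mul_assoc, mul_assoc, hE₁Θ, ← mul_assoc X, hXΘ, ← mul_assoc, ← mul_assoc, hE₂Θ, mul_assoc, mul_assoc,
          mul_assoc]
      rw [sub_mul, sub_mul, mul_sub, mul_sub, hXΘ, hp, hm]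
    exact hcommE₁ _ hX₀Θ h3
  -- the two parts `M₁`, `M₂` of `U₀` and their dimensions
  set M₁ : Submodule ℂ W := U₀ ⊓ LinearMap.range E₁ with hM₁def
  set M₂ : Submodule ℂ W := U₀ ⊓ LinearMap.range E₂ with hM₂def
  have hUM : ∀ x ∈ M₂, U x ∈ M₁ := fun x hx =>
    ⟨hU₀N U hU hUΘ hUP x hx.1, (hmemR₁ _).1 (by rw [← Module.End.mul_apply, hE₁U])⟩
  have hVM : ∀ x ∈ M₁, V x ∈ M₂ := fun x hx =>
    ⟨hU₀N V hV hVΘ hVP x hx.1, (hmemR₂ _).1 (by rw [← Module.End.mul_apply, hE₂V])⟩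
  have hle₂₁ : finrank ℂ M₂ ≤ finrank ℂ M₁ := by
    let g : M₂ →ₗ[ℂ] M₁ := LinearMap.codRestrict M₁ (U ∘ₗ M₂.subtype) fun x => hUM x x.2
    refine LinearMap.finrank_le_finrank_of_injective (f := g) ((injective_iff_map_eq_zero g).2 fun x hx => ?_)
    have h : U (x : W) = 0 := congrArg Subtype.val hx
    exact Subtype.ext (hUinj _ ((hmemR₂ _).2 x.2.2) h)
  have hle₁₂ : finrank ℂ M₁ ≤ finrank ℂ M₂ := by
    let g : M₁ →ₗ[ℂ] M₂ := LinearMap.codRestrict M₂ (V ∘ₗ M₁.subtype) fun x => hVM x x.2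
    refine LinearMap.finrank_le_finrank_of_injective (f := g) ((injective_iff_map_eq_zero g).2 fun x hx => ?_)
    have h : V (x : W) = 0 := congrArg Subtype.val hx
    exact Subtype.ext (hVinj _ ((hmemR₁ _).2 x.2.2) h)
  have hsup : M₁ ⊔ M₂ = U₀ := by
    refine le_antisymm (sup_le inf_le_left inf_le_left) fun y hy => ?_
    rw [← hsumq y (hU₀Q hy)]
    exact Submodule.add_mem_sup ⟨hU₀N E₁ hE₁ hE₁Θ hE₁P y hy, ⟨y, rfl⟩⟩ ⟨hU₀N E₂ hE₂ hE₂Θ hE₂P y hy, ⟨y, rfl⟩⟩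
  have hinf : M₁ ⊓ M₂ = ⊥ := by
    rw [eq_bot_iff]
    intro x hx
    have h1 : E₁ x = x := (hmemR₁ x).2 hx.1.2
    have h2 : E₂ x = x := (hmemR₂ x).2 hx.2.2
    rw [Submodule.mem_bot, ← h1, ← h2, ← Module.End.mul_apply, hE₁E₂, LinearMap.zero_apply]
  have hdimU₀ : finrank ℂ U₀ = finrank ℂ M₁ + finrank ℂ M₂ := by
    have h := Submodule.finrank_sup_add_finrank_inf_eq M₁ M₂
    rw [hsup, hinf, finrank_bot, add_zero] at h
    exact h
  have hU₀pos : 0 < finrank ℂ U₀ := by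
    rw [pos_iff_ne_zero, Ne, Submodule.finrank_eq_zero]; exact hU₀bot
  have hU₀lt : finrank ℂ U₀ < 4 := by
    have hfinQ : finrank ℂ Q = 4 := by
      have h := UnitaryFourTwo.finrank_add_finrank hΘΘ hP hQ
      -- `dim W = dim P + dim Q`, `dim P = dim W − dim(range E₁) − dim(range E₂)`: use `Q = range E₁ ⊕ range E₂`
      have hsupQ : LinearMap.range E₁ ⊔ LinearMap.range E₂ = Q := by
        refine le_antisymm (sup_le ?_ ?_) fun q hq => ?_
        · rintro _ ⟨w, rfl⟩; exact hE₁Q w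
        · rintro _ ⟨w, rfl⟩; exact hE₂Q w
        · rw [← hsumq q hq]; exact Submodule.add_mem_sup ⟨q, rfl⟩ ⟨q, rfl⟩
      have hinfQ : LinearMap.range E₁ ⊓ LinearMap.range E₂ = ⊥ := by
        rw [eq_bot_iff]
        intro x hx
        have h1 : E₁ x = x := (hmemR₁ x).2 hx.1
        have h2 : E₂ x = x := (hmemR₂ x).2 hx.2
        rw [Submodule.mem_bot, ← h1, ← h2, ← Module.End.mul_apply, hE₁E₂, LinearMap.zero_apply]
      have h' := Submodule.finrank_sup_add_finrank_inf_eq (LinearMap.range E₁) (LinearMap.range E₂)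
      rw [hsupQ, hinfQ, finrank_bot, add_zero, hr₁, hr₂] at h'
      omega
    rw [← hfinQ]
    exact Submodule.finrank_lt_finrank_of_lt (lt_of_le_of_ne hU₀Q hU₀top)
  have hdimM₁ : finrank ℂ M₁ = 1 := by omega
  have hdimM₂ : finrank ℂ M₂ = 1 := by omega
  -- lines are spanned by any non-zero element
  have hspan₁ : ∀ x ∈ M₁, x ≠ 0 → ∀ y ∈ M₁, y ∈ (ℂ ∙ x) := fun x hx hx0 y hy => by
    obtain ⟨c, hc⟩ := (finrank_eq_one_iff_of_nonzero' (⟨x, hx⟩ : M₁) (fun h => hx0 (congrArg Subtype.val h))).1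
      hdimM₁ ⟨y, hy⟩
    exact Submodule.mem_span_singleton.2 ⟨c, by simpa using congrArg Subtype.val hc⟩
  have hspan₂ : ∀ x ∈ M₂, x ≠ 0 → ∀ y ∈ M₂, y ∈ (ℂ ∙ x) := fun x hx hx0 y hy => by
    obtain ⟨c, hc⟩ := (finrank_eq_one_iff_of_nonzero' (⟨x, hx⟩ : M₂) (fun h => hx0 (congrArg Subtype.val h))).1
      hdimM₂ ⟨y, hy⟩
    exact Submodule.mem_span_singleton.2 ⟨c, by simpa using congrArg Subtype.val hc⟩
  -- `𝔑₀₀` preserves `M₁` and `M₂`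
  have hfix₁ : ∀ x ∈ M₁, x ≠ 0 → ∀ N ∈ 𝔊, N * Θ = Θ * N → (∀ p ∈ P, N p = 0) → N * E₂ = E₂ * N →
      N x ∈ (ℂ ∙ x) := by
    intro x hx hx0 N hN hNΘ hNP hNE₂
    refine hspan₁ x hx hx0 _ ⟨hU₀N N hN hNΘ hNP x hx.1, (hmemR₁ _).1 ?_⟩
    rw [← Module.End.mul_apply, ← hcommE₁ N hNΘ hNE₂, Module.End.mul_apply, (hmemR₁ x).2 hx.2]
  have hfix₂ : ∀ x ∈ M₂, x ≠ 0 → ∀ N ∈ 𝔊, N * Θ = Θ * N → (∀ p ∈ P, N p = 0) → N * E₁ = E₁ * N →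
      N x ∈ (ℂ ∙ x) := by
    intro x hx hx0 N hN hNΘ hNP hNE₁
    refine hspan₂ x hx hx0 _ ⟨hU₀N N hN hNΘ hNP x hx.1, (hmemR₂ _).1 ?_⟩
    rw [← Module.End.mul_apply, ← hcommE₂ N hNΘ hNE₁, Module.End.mul_apply, (hmemR₂ x).2 hx.2]
  -- §2 and §3 in the two orientations
  have hB₁ : ∀ x ∈ M₁, x ≠ 0 → (∃ Z ∈ 𝔊, Z * Θ = Θ * Z ∧ Z * E₂ = E₂ * Z ∧ Z x ∉ U₀) →
      (∀ X ∈ 𝔊, X * Θ = Θ * X → ∃ c : ℂ, E₁ * X * E₂ = c • U) ∧ ∃ α₀ : ℂ, α₀ ≠ 0 ∧ U * V = α₀ • E₁ := by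
    intro x hx hx0 hmv
    obtain ⟨Z, hZ, hZΘ, hZE₂, hZx⟩ := hmv
    refine UnitaryFourTwo.raise_line_of_mover hbr hΘΘ hP hU hV hUΘ hVΘ hE₁P hE₂P hsum hE₁E₁ hE₂E₂ hE₁E₂ hE₂E₁
      hE₁Θ hE₂Θ hE₁U hUE₂ hE₂V hVE₁ hUonto hVonto hr₁ (fun X hX hXΘ => (hgraded X hX hXΘ).1)
      ((hmemR₁ x).2 hx.2) hx0 (hfix₁ x hx hx0) ⟨Z, hZ, hZΘ, hZE₂, fun hmem => hZx ?_⟩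
    have hZx' : Z x ∈ LinearMap.range E₁ := (hmemR₁ _).1 (by
      rw [← Module.End.mul_apply, ← hcommE₁ Z hZΘ hZE₂, Module.End.mul_apply, (hmemR₁ x).2 hx.2])
    have hle : (ℂ ∙ x) ≤ U₀ := (Submodule.span_singleton_le_iff_mem x U₀).2 hx.1
    exact hle hmem
  have hB₂ : ∀ x ∈ M₂, x ≠ 0 → (∃ Z ∈ 𝔊, Z * Θ = Θ * Z ∧ Z * E₁ = E₁ * Z ∧ Z x ∉ U₀) →
      (∀ X ∈ 𝔊, X * Θ = Θ * X → ∃ c : ℂ, E₂ * X * E₁ = c • V) ∧ ∃ β₀ : ℂ, β₀ ≠ 0 ∧ V * U = β₀ • E₂ := by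
    intro x hx hx0 hmv
    obtain ⟨Z, hZ, hZΘ, hZE₁, hZx⟩ := hmv
    refine UnitaryFourTwo.raise_line_of_mover hbr hΘΘ hP hV hU hVΘ hUΘ hE₂P hE₁P hsum' hE₂E₂ hE₁E₁ hE₂E₁ hE₁E₂
      hE₂Θ hE₁Θ hE₂V hVE₁ hE₁U hUE₂ hVonto hUonto hr₂ (fun X hX hXΘ => (hgraded X hX hXΘ).2.1)
      ((hmemR₂ x).2 hx.2) hx0 (hfix₂ x hx hx0) ⟨Z, hZ, hZΘ, hZE₁, fun hmem => hZx ?_⟩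
    have hle : (ℂ ∙ x) ≤ U₀ := (Submodule.span_singleton_le_iff_mem x U₀).2 hx.1
    exact hle hmem
  have hC₁ : (∀ X ∈ 𝔊, X * Θ = Θ * X → ∃ c : ℂ, E₁ * X * E₂ = c • U) → ∀ α₀ : ℂ, α₀ ≠ 0 → U * V = α₀ • E₁ →
      ∃ Z ∈ 𝔊, Z * Θ = Θ * Z ∧ Z * E₁ = E₁ * Z ∧ ∃ x ∈ M₂, x ≠ 0 ∧ Z x ∉ U₀ := by
    intro hline α₀ hα₀ hUV
    obtain ⟨Z, hZ, hZΘ, hZE₂, x, hxU₀, hxE₂, hZx⟩ := UnitaryFourTwo.mover_of_raise_line hbr hQ hE₁ hE₂ hU hV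
      hUΘ hVΘ hE₁P hE₂P hsum hE₁E₁ hE₂E₂ hE₁Θ hE₂Θ hE₁U hUE₂ hE₂V hVE₁ hlevi hgraded hU₀Q hU₀bot hU₀top
      hU₀N hline hα₀ hUV
    refine ⟨Z, hZ, hZΘ, hcommE₁ Z hZΘ hZE₂, x, ⟨hxU₀, (hmemR₂ x).1 hxE₂⟩, fun h0 => hZx ?_, hZx⟩
    rw [h0, map_zero]; exact Submodule.zero_mem _
  have hC₂ : (∀ X ∈ 𝔊, X * Θ = Θ * X → ∃ c : ℂ, E₂ * X * E₁ = c • V) → ∀ β₀ : ℂ, β₀ ≠ 0 → V * U = β₀ • E₂ →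
      ∃ Z ∈ 𝔊, Z * Θ = Θ * Z ∧ Z * E₂ = E₂ * Z ∧ ∃ x ∈ M₁, x ≠ 0 ∧ Z x ∉ U₀ := by
    intro hline β₀ hβ₀ hVU
    obtain ⟨Z, hZ, hZΘ, hZE₁, x, hxU₀, hxE₁, hZx⟩ := UnitaryFourTwo.mover_of_raise_line hbr hQ hE₂ hE₁ hV hU
      hVΘ hUΘ hE₂P hE₁P hsum' hE₂E₂ hE₁E₁ hE₂Θ hE₁Θ hE₂V hVE₁ hE₁U hUE₂ hlevi hgraded' hU₀Q hU₀bot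
      hU₀top hU₀N hline hβ₀ hVU
    refine ⟨Z, hZ, hZΘ, hcommE₂ Z hZΘ hZE₁, x, ⟨hxU₀, (hmemR₁ x).1 hxE₁⟩, fun h0 => hZx ?_, hZx⟩
    rw [h0, map_zero]; exact Submodule.zero_mem _
  -- a first mover, from level-one irreducibility
  have hfirst : (∃ x ∈ M₁, x ≠ 0 ∧ ∃ Z ∈ 𝔊, Z * Θ = Θ * Z ∧ Z * E₂ = E₂ * Z ∧ Z x ∉ U₀) ∨
      (∃ x ∈ M₂, x ≠ 0 ∧ ∃ Z ∈ 𝔊, Z * Θ = Θ * Z ∧ Z * E₁ = E₁ * Z ∧ Z x ∉ U₀) := by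
    by_contra hno
    push Not at hno
    obtain ⟨hno₁, hno₂⟩ := hno
    have hstab : ∀ X ∈ 𝔊, X * Θ = Θ * X → ∀ y ∈ U₀, X y ∈ U₀ := by
      intro X hX hXΘ y hy
      obtain ⟨hXp, hXm, hX₀E₂⟩ := hgraded X hX hXΘ
      set Xp : Module.End ℂ W := E₁ * X * E₂ with hXpdef
      set Xm : Module.End ℂ W := E₂ * X * E₁ with hXmdef
      set X₀ : Module.End ℂ W := X - Xp - Xm with hX₀def
      clear_value Xp Xm X₀
      have hXpΘ : Xp * Θ = Θ * Xp := by
        rw [hXpdef, mul_assoc, mul_assoc, hE₂Θ, ← mul_assoc X, hXΘ, ← mul_assoc, ← mul_assoc, hE₁Θ, mul_assoc,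
          mul_assoc, mul_assoc]
      have hXmΘ : Xm * Θ = Θ * Xm := by
        rw [hXmdef, mul_assoc, mul_assoc, hE₁Θ, ← mul_assoc X, hXΘ, ← mul_assoc, ← mul_assoc, hE₂Θ, mul_assoc,
          mul_assoc, mul_assoc]
      have hXpP : ∀ p ∈ P, Xp p = 0 := fun p hp => by rw [hXpdef, Module.End.mul_apply, hE₂P p hp, map_zero]
      have hXmP : ∀ p ∈ P, Xm p = 0 := fun p hp => by rw [hXmdef, Module.End.mul_apply, hE₁P p hp, map_zero]
      have hX₀ : X₀ ∈ 𝔊 := by rw [hX₀def]; exact Submodule.sub_mem _ (Submodule.sub_mem _ hX hXp) hXm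
      have hX₀Θ : X₀ * Θ = Θ * X₀ := by rw [hX₀def, sub_mul, sub_mul, mul_sub, mul_sub, hXΘ, hXpΘ, hXmΘ]
      have hX₀E₁ : X₀ * E₁ = E₁ * X₀ := hcommE₁ X₀ hX₀Θ hX₀E₂
      have hyQ : y ∈ Q := hU₀Q hy
      have hy₁ : E₁ y ∈ M₁ := ⟨hU₀N E₁ hE₁ hE₁Θ hE₁P y hy, ⟨y, rfl⟩⟩
      have hy₂ : E₂ y ∈ M₂ := ⟨hU₀N E₂ hE₂ hE₂Θ hE₂P y hy, ⟨y, rfl⟩⟩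
      have h₁ : X₀ (E₁ y) ∈ U₀ := by
        by_cases h0 : E₁ y = 0
        · rw [h0, map_zero]; exact Submodule.zero_mem _
        · exact hno₁ _ hy₁ h0 X₀ hX₀ hX₀Θ hX₀E₂
      have h₂ : X₀ (E₂ y) ∈ U₀ := by
        by_cases h0 : E₂ y = 0
        · rw [h0, map_zero]; exact Submodule.zero_mem _
        · exact hno₂ _ hy₂ h0 X₀ hX₀ hX₀Θ hX₀E₁
      have hX₀y : X₀ y = X₀ (E₁ y) + X₀ (E₂ y) := by rw [← map_add, hsumq y hyQ]
      have hXy : X y = Xp y + Xm y + (X₀ (E₁ y) + X₀ (E₂ y)) := by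
        rw [← hX₀y, hX₀def, LinearMap.sub_apply, LinearMap.sub_apply]
        abel
      rw [hXy]
      exact Submodule.add_mem _ (Submodule.add_mem _ (hU₀N Xp hXp hXpΘ hXpP y hy) (hU₀N Xm hXm hXmΘ hXmP y hy))
        (Submodule.add_mem _ h₁ h₂)
    rcases hlevi U₀ hU₀Q hstab with h | h
    · exact hU₀bot h
    · exact hU₀top h
  -- both lines
  have hboth : ((∀ X ∈ 𝔊, X * Θ = Θ * X → ∃ c : ℂ, E₁ * X * E₂ = c • U) ∧ ∃ α₀ : ℂ, α₀ ≠ 0 ∧ U * V = α₀ • E₁) ∧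
      ((∀ X ∈ 𝔊, X * Θ = Θ * X → ∃ c : ℂ, E₂ * X * E₁ = c • V) ∧ ∃ β₀ : ℂ, β₀ ≠ 0 ∧ V * U = β₀ • E₂) := by
    rcases hfirst with ⟨x, hx, hx0, hmv⟩ | ⟨x, hx, hx0, hmv⟩
    · obtain ⟨hline, α₀, hα₀, hUV⟩ := hB₁ x hx hx0 hmv
      obtain ⟨Z, hZ, hZΘ, hZE₁, x', hx', hx'0, hZx'⟩ := hC₁ hline α₀ hα₀ hUV
      exact ⟨⟨hline, α₀, hα₀, hUV⟩, hB₂ x' hx' hx'0 ⟨Z, hZ, hZΘ, hZE₁, hZx'⟩⟩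
    · obtain ⟨hline, β₀, hβ₀, hVU⟩ := hB₂ x hx hx0 hmv
      obtain ⟨Z, hZ, hZΘ, hZE₂, x', hx', hx'0, hZx'⟩ := hC₂ hline β₀ hβ₀ hVU
      exact ⟨hB₁ x' hx' hx'0 ⟨Z, hZ, hZΘ, hZE₂, hZx'⟩, ⟨hline, β₀, hβ₀, hVU⟩⟩
  obtain ⟨⟨hline₁, α₀, hα₀, hUV⟩, ⟨hline₂, β₀, hβ₀, hVU⟩⟩ := hboth
  -- `α₀ = β₀`: `UVU = α₀ U = β₀ U`, `U ≠ 0`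
  have hU0 : U ≠ 0 := by
    intro h0
    have hpos : 0 < finrank ℂ (LinearMap.range E₁) := by rw [hr₁]; exact two_pos
    obtain ⟨⟨x, hx⟩, hx0⟩ := Module.finrank_pos_iff_exists_ne_zero.1 hpos
    obtain ⟨k, -, hkx⟩ := hUonto x ((hmemR₁ x).2 hx)
    apply hx0
    apply Subtype.ext
    change x = 0
    rw [← hkx, h0, LinearMap.zero_apply]
  have hαβ : α₀ = β₀ := by
    have h1 : U * V * U = α₀ • U := by rw [hUV, smul_mul_assoc, hE₁U]
    have h2 : U * V * U = β₀ • U := by rw [mul_assoc, hVU, mul_smul_comm, hUE₂]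
    have h : (α₀ - β₀) • U = 0 := by rw [sub_smul, ← h1, ← h2, sub_self]
    exact sub_eq_zero.1 ((smul_eq_zero.1 h).resolve_right hU0)
  refine ⟨fun X hX hXΘ => ⟨hline₁ X hX hXΘ, hline₂ X hX hXΘ⟩, α₀, hα₀, hUV, ?_⟩
  rw [hαβ]; exact hVU

end Lines

end HodgeStructure

end Literature.AlgebraicGeometry.Motives

end
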